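import Summits.SmoothPoincare4.SmoothPoincare4.Theorems.WeakReductionDescentDependentTripleGenusThreeStandard
import Literature.Topology.FourManifolds.WeaklyReducibleTrisections
import Literature.Barriers.SmoothPoincare4.LowGenusTrisectionsStandardOfClassification
import Literature.Barriers.SmoothPoincare4.WeaklyReducibleGenusThreeStandard
import Literature.Topology.FourManifolds.LargeKTrisectionClassification
import Literature.Topology.FourManifolds.SphereTrisectionsSectors
import Literature.Topology.FourManifolds.TrisectionsProofs
import Literature.Topology.FourManifolds.TrisectionsStabilization
import Literature.Topology.FourManifolds.TrisectionFunctorGKCentralSurface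
import Literature.Topology.FourManifolds.HomotopyS4OrientableProofs
import Literature.Topology.FourManifolds.HomotopyS4CompactProofs
import Literature.Topology.FourManifolds.SphereSimplyConnected
import Literature.Topology.FourManifolds.ConnectedSumSummands
import Literature.Topology.FourManifolds.ConnectedSumTransportProofs
import Literature.Topology.FourManifolds.CircleSurgery

/-!
# `DependentTripleGenusThreeStandard` — negative-side support for the picked line `Sketch`:
# refutation cost, shields of stubs 1 and 4, and TIGHTNESS of stub 2 (two refuted variants of
# Meier–Schirmer–Zupan's classification) (crux stmt-SmoothPoincare4-18000, cdisprove seat, cycle 1)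

Crux X_F `WeakReductionDescent.DependentTripleGenusThreeStandard` (= Aranda–Zupan 2025 Thm 1.4 /
Cor 1.5 for homotopy spheres, `Theorems.dependentTripleGenusThreeStandard_iff_arandaZupan`) and its
registered skeleton `Cruxes/DependentTripleGenusThreeStandard/Lines/Sketch.lean` (stubs
`stub_weaklyReducibleStandard`, `stub_mszClassification`, `stub_separatingPairReducing`,
`stub_loopPartnerNoRange`).  Everything here is proved; no definition, no named fact; every
statement a variant of a stub is written INLINE.

* `not_smoothPoincare4_of_not_dependentTripleGenusThreeStandard` — REFUTATION COST of the crux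
  (contrapositive of the landed `Theorems.dependentTripleGenusThreeStandard_of_smoothPoincare`):
  a kill is an exotic `S⁴`.
* `stub_weaklyReducibleStandard_of_smoothPoincare4` — stub 1
  (`az2025_weaklyReducible_genusThree_homotopySphere_gk.{0}`) is SPC4-implied: not killable either.
* `stub_mszClassification_false_with_max` — TIGHTNESS (i) of stub 2
  (`msz_trisection_classification_gk.{0}`, MSZ16 Thm 1.2 with the tree's `k′ = min{k₁, k₂}`): the
  same statement with the PRINTED `k′ = max{k₂, k₃}` is FALSE — witness the `(1; 0,1,0)`
  stabilisation of Gay–Kirby's genus-`0` trisection of the round `S⁴`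
  (`sphere_genusZero_gkTrisection_holds`, `IsGKTrisection.exists_stabilizeOne`), for which
  `g = 1 = k₀ + 1` and `max = 1`, while `S⁴` is neither `#¹(S¹ × S³)` nor `M # ℂP²` with
  `M ⊇ S¹ × S³`-summand (`π₁`; `sphereFour_not_mszConclusion_succ`).  The paper argument for the
  misprint in `LargeKTrisectionClassification.lean` is thereby kernel-certified.
* `stub_mszClassification_false_with_relaxed_range` — TIGHTNESS (ii): the MSZ range `k₀ + 1 ≥ g`
  cannot be widened to `k₀ + 2 ≥ g` — witness the `(3; 1,1,1)` stabilisation of the genus-`0`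
  trisection of `S⁴` (`IsGKTrisection.exists_stabilization`), `min = 1`.  So a proof of stub 2
  must use the range and produce `min`, and the route's `(3;1,1,1)` type is certified to lie
  outside every classification of MSZ shape (the homotopy-sphere corollary with the widened range
  stays SPC4-shielded; only the classification-with-list is refuted).
* `stub_separatingPairReducing_of_noSphere` — for stub 3 (AZ25 Lemma 3.8 at `Y = S¹ × S²`) the
  hypothesis `e : M ≃ₕ S⁴` is DECORATION: the `e`-free statement (still Lemma 3.8, true in print
  for every closed `(3;1,1,1)`-trisected 4-manifold) implies it by deletion.  Stub 3 is the only
  unshielded geometric stub; its load-bearing hypothesis on paper is mutual separation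
  (`Cruxes/…/Disproof.lean`, stub 3 record).
* `stub_loopPartnerNoRange_of_smoothPoincare4_of_presentation` — stub 4 is SPC4-implied MODULO the
  inline presentation "the round `S⁴` is a circle surgery on some `ℝ⁴`-charted `X′` with a
  GK-trisection of genus `≤ 2`" (true in print: `X′ = S¹ × S³`, fibre circle; the tree proves the
  cross-model form `isCircleSurgery_sphereOne_prod_sphereThree_sphereFour` only): transport the
  gluing along `S⁴ ≅ M` (`isCircleSurgery_of_diffeomorph_result`,
  `IsOpenGluing.diffeomorph_comp_of_boundaryless`).

Full analysis (load-bearing hypotheses of the crux, paper witnesses, why it resists):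
`Cruxes/DependentTripleGenusThreeStandard/Disproof.lean` and `BirthAttack.lean`.
-/

noncomputable section

-- the prescribed namespace `Summit.<P>.<Sub>.…` duplicates `SmoothPoincare4` (P = Sub)
set_option linter.dupNamespace false

open scoped Manifold ContDiff Topology ContinuousMap
open Set
open Literature.Topology.FourManifolds
open Literature.Topology.FourManifolds.Trisection
open Summit.SmoothPoincare4.SmoothPoincare4.Theses.WeakReductionDescent

namespace Summit.SmoothPoincare4.SmoothPoincare4.Theorems.DependentTripleGenusThreeStandard.Negative

/-! ### Refutation cost of the crux and of stub 1 -/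

/-- **A refutation of X_F refutes the summit** (contrapositive of the landed
`Theorems.dependentTripleGenusThreeStandard_of_smoothPoincare`): a kill is an exotic `S⁴` of
trisection genus `≤ 3`. [folklore] -/
theorem not_smoothPoincare4_of_not_dependentTripleGenusThreeStandard
    (h : ¬ DependentTripleGenusThreeStandard) : ¬ _root_.SmoothPoincare4 :=
  fun hs => h (Summit.SmoothPoincare4.SmoothPoincare4.Theorems.dependentTripleGenusThreeStandard_of_smoothPoincare hs)

/-- **Stub 1 of the line (`az2025_weaklyReducible_genusThree_homotopySphere_gk.{0}`, AZ25 Thm 1.3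
for homotopy spheres) is SPC4-implied**, hence not refutable short of an exotic `S⁴`
(the tree's `…_of_smoothPoincare`, fed with the summit). [cite: ArandaZupan2025, Thm. 1.3 (p. 2)] -/
theorem stub_weaklyReducibleStandard_of_smoothPoincare4 (h : _root_.SmoothPoincare4) :
    Literature.Barriers.SmoothPoincare4.az2025_weaklyReducible_genusThree_homotopySphere_gk.{0} :=
  Literature.Barriers.SmoothPoincare4.az2025_weaklyReducible_genusThree_homotopySphere_gk_of_smoothPoincare
    fun X _ _ _ _ _ _ e => h X ‹_› ‹_› e

/-! ### Tightness of stub 2 (Meier–Schirmer–Zupan's classification) -/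

/-- The round `S⁴` is compact, simply connected and smoothly orientable (tree theorems fed with
the identity homotopy equivalence). [cite: HatcherAT2002, Prop. 1.14 and Prop. 3.29] -/
theorem sphereFour_compact_simplyConnected_orientable :
    CompactSpace (Metric.sphere (0 : EuclideanSpace ℝ (Fin (4 + 1))) 1) ∧ SimplyConnectedSpace (Metric.sphere (0 : EuclideanSpace ℝ (Fin (4 + 1))) 1) ∧ Nonempty (SmoothOrientation (𝓡 4) (Metric.sphere (0 : EuclideanSpace ℝ (Fin (4 + 1))) 1)) :=
  ⟨compactSpace_of_homotopyEquiv_sphere_four_holds _ (ContinuousMap.HomotopyEquiv.refl _),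
    simplyConnectedSpace_sphere_four_holds,
    isOrientable_of_homotopyEquiv_sphere_four_holds _ (ContinuousMap.HomotopyEquiv.refl _)⟩

/-- **No conclusion of MSZ shape with `k′ ≥ 1` holds for the round `S⁴`**: `#^{n+1}(S¹ × S³)` is
not simply connected (`IsCircleProdSum.not_simplyConnectedSpace_succ`), and a `ℂP²`-cosummand `M`
of the simply connected `S⁴` is simply connected (`IsConnectedSum.simplyConnectedSpace_left`,
Kosinski VI.2), so it is not `#^{n+1}(S¹ × S³)` either. [cite: Kosinski1993, Ch. VI §2, Prop. 2.1] -/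
theorem sphereFour_not_mszConclusion_succ (n : ℕ) :
    ¬ (IsCircleProdSum (n + 1) (Metric.sphere (0 : EuclideanSpace ℝ (Fin (4 + 1))) 1) ∨
      ∃ (M : Type) (_ : TopologicalSpace M) (_ : T2Space M) (_ : SecondCountableTopology M)
        (_ : ChartedSpace (EuclideanSpace ℝ (Fin 4)) M) (_ : IsManifold (𝓡 4) ∞ M) (_ : CompactSpace M)
        (_ : ConnectedSpace M),
        IsCircleProdSum (n + 1) M ∧
          IsConnectedSum (𝓡 4) (𝓡 4) (𝓡 4) M ComplexProjectivePlane (Metric.sphere (0 : EuclideanSpace ℝ (Fin (4 + 1))) 1)) := by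
  haveI : SimplyConnectedSpace (Metric.sphere (0 : EuclideanSpace ℝ (Fin (4 + 1))) 1) := simplyConnectedSpace_sphere_four_holds
  rintro (h1 | ⟨M, _, _, _, _, _, _, _, hM, hsum⟩)
  · exact Literature.Barriers.SmoothPoincare4.IsCircleProdSum.not_simplyConnectedSpace_succ h1 ‹_›
  · haveI : SimplyConnectedSpace M :=
      hsum.simplyConnectedSpace_left (by rw [finrank_euclideanSpace_fin]; norm_num)
    exact Literature.Barriers.SmoothPoincare4.IsCircleProdSum.not_simplyConnectedSpace_succ hM ‹_›

/-- **TIGHTNESS (i) of stub 2: Meier–Schirmer–Zupan's Thm 1.2 with the PRINTED `k′ = max{k₂, k₃}`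
(here `max (k 1) (k 2)`, the sector `S 0` playing `X₁`; everything else verbatim as in
`msz_trisection_classification_gk`) is FALSE.**  Witness: one implant on the sector `1` turns
Gay–Kirby's genus-`0` trisection of the round `S⁴` into a `(1; 0,1,0)`-trisection
(`sphere_genusZero_gkTrisection_holds`, `IsGKTrisection.exists_stabilizeOne`), with
`g = 1 ≤ k₀ + 1` and `max{k₁, k₂} = 1`; but `S⁴` admits no MSZ conclusion with `k′ = 1`
(`sphereFour_not_mszConclusion_succ`).  So the registered stub's `min` is the only tenable
reading, as argued on paper in `LargeKTrisectionClassification.lean`.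
[cite: MeierSchirmerZupan2016, Thm. 1.2 (as printed) and Remark 5.2] [cite: GayKirby2016, Def. 8, Lemma 10] -/
theorem stub_mszClassification_false_with_max :
    ¬ ∀ (X : Type) [TopologicalSpace X] [T2Space X] [SecondCountableTopology X]
        [ChartedSpace (EuclideanSpace ℝ (Fin 4)) X] [IsManifold (𝓡 4) ∞ X] [CompactSpace X] [ConnectedSpace X]
        (_ : SmoothOrientation (𝓡 4) X) (g : ℕ) (k : Fin 3 → ℕ) (S : Fin 3 → Set X),
        IsGKTrisection X g k S → g ≤ k 0 + 1 →
          IsCircleProdSum (max (k 1) (k 2)) X ∨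
          ∃ (M : Type) (_ : TopologicalSpace M) (_ : T2Space M) (_ : SecondCountableTopology M)
            (_ : ChartedSpace (EuclideanSpace ℝ (Fin 4)) M) (_ : IsManifold (𝓡 4) ∞ M) (_ : CompactSpace M)
            (_ : ConnectedSpace M),
            IsCircleProdSum (max (k 1) (k 2)) M ∧
              IsConnectedSum (𝓡 4) (𝓡 4) (𝓡 4) M ComplexProjectivePlane X := by
  intro h
  obtain ⟨hc, hsc, ⟨o⟩⟩ := sphereFour_compact_simplyConnected_orientable
  haveI := hc
  haveI := hsc
  obtain ⟨S₀, hS₀⟩ := sphere_genusZero_gkTrisection_holds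
  have hT₀ : IsGKTrisection (Metric.sphere (0 : EuclideanSpace ℝ (Fin (4 + 1))) 1) 0 (fun _ => 0) S₀ := hS₀.isGKTrisection
  obtain ⟨S₁, hT₁, -⟩ := hT₀.exists_stabilizeOne hT₀.nonempty_iInter 1
  have key := h (Metric.sphere (0 : EuclideanSpace ℝ (Fin (4 + 1))) 1) o (0 + 1) _ S₁ hT₁ (by simp)
  have hmax : max (Function.update (fun _ : Fin 3 => (0 : ℕ)) 1 ((fun _ : Fin 3 => (0 : ℕ)) 1 + 1) 1)
      (Function.update (fun _ : Fin 3 => (0 : ℕ)) 1 ((fun _ : Fin 3 => (0 : ℕ)) 1 + 1) 2) = 0 + 1 := by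
    simp [Function.update]
  rw [hmax] at key
  exact sphereFour_not_mszConclusion_succ 0 key

/-- **TIGHTNESS (ii) of stub 2: the MSZ range `k₀ + 1 ≥ g` cannot be widened to `k₀ + 2 ≥ g`**
(everything else verbatim as registered, `k′ = min`).  Witness: three implants turn the genus-`0`
trisection of the round `S⁴` into a `(3; 1,1,1)`-trisection (`IsGKTrisection.exists_stabilization`),
with `g = 3 ≤ k₀ + 2` and `min{k₁, k₂} = 1`, and `S⁴` admits no MSZ conclusion with `k′ = 1`.
Hence a proof of stub 2 must USE `k₀ + 1 ≥ g`, and the route's `(3;1,1,1)` type lies outside every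
classification of MSZ shape — in the kernel, not only in print.  (The homotopy-sphere COROLLARY with
the widened range is not refuted: it is SPC4-implied.)
[cite: MeierSchirmerZupan2016, Thm. 1.2] [cite: GayKirby2016, §2 ("Stabilizing the genus 0 trisection of S⁴ gives a genus 3 trisection")] -/
theorem stub_mszClassification_false_with_relaxed_range :
    ¬ ∀ (X : Type) [TopologicalSpace X] [T2Space X] [SecondCountableTopology X]
        [ChartedSpace (EuclideanSpace ℝ (Fin 4)) X] [IsManifold (𝓡 4) ∞ X] [CompactSpace X] [ConnectedSpace X]
        (_ : SmoothOrientation (𝓡 4) X) (g : ℕ) (k : Fin 3 → ℕ) (S : Fin 3 → Set X),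
        IsGKTrisection X g k S → g ≤ k 0 + 2 →
          IsCircleProdSum (min (k 1) (k 2)) X ∨
          ∃ (M : Type) (_ : TopologicalSpace M) (_ : T2Space M) (_ : SecondCountableTopology M)
            (_ : ChartedSpace (EuclideanSpace ℝ (Fin 4)) M) (_ : IsManifold (𝓡 4) ∞ M) (_ : CompactSpace M)
            (_ : ConnectedSpace M),
            IsCircleProdSum (min (k 1) (k 2)) M ∧
              IsConnectedSum (𝓡 4) (𝓡 4) (𝓡 4) M ComplexProjectivePlane X := by
  intro h
  obtain ⟨hc, hsc, ⟨o⟩⟩ := sphereFour_compact_simplyConnected_orientable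
  haveI := hc
  haveI := hsc
  obtain ⟨S₀, hS₀⟩ := sphere_genusZero_gkTrisection_holds
  have hT₀ : IsGKTrisection (Metric.sphere (0 : EuclideanSpace ℝ (Fin (4 + 1))) 1) 0 (fun _ => 0) S₀ := hS₀.isGKTrisection
  obtain ⟨S₃, hT₃, -⟩ := hT₀.exists_stabilization hT₀.nonempty_iInter
  have key := h (Metric.sphere (0 : EuclideanSpace ℝ (Fin (4 + 1))) 1) o (0 + 3) _ S₃ hT₃ (by simp)
  have hmin : min ((fun _ : Fin 3 => (0 : ℕ) + 1) 1) ((fun _ : Fin 3 => (0 : ℕ) + 1) 2) = 0 + 1 := by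
    simp
  rw [hmin] at key
  exact sphereFour_not_mszConclusion_succ 0 key

/-- Consistency check: the registered stub 2 itself (`k′ = min`, range `k₀ + 1 ≥ g`) is untouched
by the two witnesses — at the `(1; 0,1,0)` trisection of `S⁴` it asks for
`IsCircleProdSum (min 1 0) S⁴ = IsCircleProdSum 0 S⁴`, which holds (`IsCircleProdSum.sphere_self`),
and the `(3;1,1,1)` trisection is outside its range. [cite: MeierZupan2017, §1 ("#^0(S¹ × S³) = S⁴")] -/
theorem stub_mszClassification_consistent_at_witness :
    IsCircleProdSum (min (Function.update (fun _ : Fin 3 => (0 : ℕ)) 1 ((fun _ : Fin 3 => (0 : ℕ)) 1 + 1) 1)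
      (Function.update (fun _ : Fin 3 => (0 : ℕ)) 1 ((fun _ : Fin 3 => (0 : ℕ)) 1 + 1) 2)) (Metric.sphere (0 : EuclideanSpace ℝ (Fin (4 + 1))) 1) := by
  have hmin : min (Function.update (fun _ : Fin 3 => (0 : ℕ)) 1 ((fun _ : Fin 3 => (0 : ℕ)) 1 + 1) 1)
      (Function.update (fun _ : Fin 3 => (0 : ℕ)) 1 ((fun _ : Fin 3 => (0 : ℕ)) 1 + 1) 2) = 0 := by
    simp [Function.update]
  rw [hmin]
  exact IsCircleProdSum.sphere_self

/-! ### Stub 3: the homotopy equivalence is decoration -/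

/-- **Stub 3 (`stub_separatingPairReducing`, AZ25 Lemma 3.8 at `Y = S¹ × S²`) follows by deletion
from its `e`-free form**, which is STILL Lemma 3.8 (the genus-3 splitting `H_i ∪_F H_j` of
`∂T_l ≅ S¹ × S²` of any closed `(3;1,1,1)`-trisected 4-manifold) and true in print: the printed
proof (untelescoping along the pair; the thin level is two tori, compressible in `S¹ × S²`; a thick
genus-2 level is then weakly reducible, hence reducible; its separating reducing curve bounds the
unique separating disc of the compression body, so it is isotopic to the partner curve) never uses
the ambient 4-manifold.  A prover should discharge the `e`-free form.
[cite: ArandaZupan2025, Lemma 3.8 (p. 10), Prop. 2.4, Lemmas 3.4 and 3.6] -/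
theorem stub_separatingPairReducing_of_noSphere
    (h : ∀ (M : Type) [TopologicalSpace M] [T2Space M] [SecondCountableTopology M]
      [ChartedSpace (EuclideanSpace ℝ (Fin 4)) M] [IsManifold (𝓡 4) ∞ M],
      ∀ T : Fin 3 → Set M, IsGKTrisection M 3 (fun _ => 1) T →
      ∀ i j : Fin 3, i ≠ j → ∀ a b : Set M, IsCurve T a → IsCurve T b →
      BoundsDisc T (spineHandlebody T i) a → BoundsDisc T (spineHandlebody T j) b →
      Disjoint a b → IsNonSeparating T a → IsNonSeparating T b →
      ¬ IsConnected (centralSurfaceSet T \ (a ∪ b)) →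
      BoundsDisc T (spineHandlebody T j) a ∨ BoundsDisc T (spineHandlebody T i) b) :
    ∀ (M : Type) [TopologicalSpace M] [T2Space M] [SecondCountableTopology M]
      [ChartedSpace (EuclideanSpace ℝ (Fin 4)) M] [IsManifold (𝓡 4) ∞ M],
      M ≃ₕ (Metric.sphere (0 : EuclideanSpace ℝ (Fin (4 + 1))) 1) → ∀ T : Fin 3 → Set M, IsGKTrisection M 3 (fun _ => 1) T →
      ∀ i j : Fin 3, i ≠ j → ∀ a b : Set M, IsCurve T a → IsCurve T b →
      BoundsDisc T (spineHandlebody T i) a → BoundsDisc T (spineHandlebody T j) b →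
      Disjoint a b → IsNonSeparating T a → IsNonSeparating T b →
      ¬ IsConnected (centralSurfaceSet T \ (a ∪ b)) →
      BoundsDisc T (spineHandlebody T j) a ∨ BoundsDisc T (spineHandlebody T i) b := by
  intro M _ _ _ _ _ _e T hT i j hij a b ha hb hda hdb hab hna hnb hsep
  exact h M T hT i j hij a b ha hb hda hdb hab hna hnb hsep

/-! ### Stub 4: shielded modulo a presentation of the round sphere -/

/-- **Circle surgery is transported along diffeomorphisms of the RESULT**: if `P` is obtained from
`X′` by surgery on `ℓ` and `Φ : P ≅ M`, so is `M` (same tube; compose the open gluing with `Φ`,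
`IsOpenGluing.diffeomorph_comp_of_boundaryless`). [cite: Kosinski1993, Ch. VI §1, proof of Thm 1.1] -/
theorem isCircleSurgery_of_diffeomorph_result {X' : Type} [TopologicalSpace X'] [T2Space X']
    [ChartedSpace (EuclideanSpace ℝ (Fin 4)) X'] {ℓ : Metric.sphere (0 : EuclideanSpace ℝ (Fin 2)) 1 → X'}
    {P : Type} [TopologicalSpace P] [ChartedSpace (EuclideanSpace ℝ (Fin 4)) P]
    {M : Type} [TopologicalSpace M] [ChartedSpace (EuclideanSpace ℝ (Fin 4)) M] [IsManifold (𝓡 4) ∞ M]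
    (h : IsCircleSurgery (𝓡 4) (𝓡 4) X' P ℓ) (Φ : P ≃ₘ⟮𝓡 4, 𝓡 4⟯ M) :
    IsCircleSurgery (𝓡 4) (𝓡 4) X' M ℓ := by
  obtain ⟨ν, hν⟩ := h
  exact ⟨ν, hν.diffeomorph_comp_of_boundaryless Φ⟩

/-- **Stub 4 (`stub_loopPartnerNoRange`, AZ25 §7 case (3)) is SPC4-implied MODULO the presentation
"the round `S⁴` is a circle surgery on some `ℝ⁴`-charted smooth `X′` with a GK-trisection of genus
`≤ 2`"** (true in print with `X′ = S¹ × S³`, the fibre circle and the `(1;1,1,1)`-trisection; the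
tree proves the cross-model form `isCircleSurgery_sphereOne_prod_sphereThree_sphereFour` only):
under the summit `M ≅ S⁴` and the presentation moves along the diffeomorphism; the trisection, the
pants triple and `¬ IsWeaklyReducible T` are unused.  So stub 4 is not refutable short of an exotic
`S⁴`. [cite: ArandaZupan2025, §7 (pp. 25–26) and §2 (p. 7)] [cite: Kirby1989, Ch. I §2] -/
theorem stub_loopPartnerNoRange_of_smoothPoincare4_of_presentation (hS : _root_.SmoothPoincare4)
    (hP : ∃ (X' : Type) (_ : TopologicalSpace X') (_ : T2Space X') (_ : SecondCountableTopology X')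
      (_ : ChartedSpace (EuclideanSpace ℝ (Fin 4)) X') (_ : IsManifold (𝓡 4) ∞ X')
      (g' : ℕ) (k' : Fin 3 → ℕ) (T' : Fin 3 → Set X')
      (ℓ : Metric.sphere (0 : EuclideanSpace ℝ (Fin 2)) 1 → X'),
      g' ≤ 2 ∧ IsGKTrisection X' g' k' T' ∧ IsCircleSurgery (𝓡 4) (𝓡 4) X' (Metric.sphere (0 : EuclideanSpace ℝ (Fin (4 + 1))) 1) ℓ) :
    ∀ (M : Type) [TopologicalSpace M] [T2Space M] [SecondCountableTopology M]
      [ChartedSpace (EuclideanSpace ℝ (Fin 4)) M] [IsManifold (𝓡 4) ∞ M],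
      M ≃ₕ (Metric.sphere (0 : EuclideanSpace ℝ (Fin (4 + 1))) 1) → ∀ T : Fin 3 → Set M, IsGKTrisection M 3 (fun _ => 1) T →
      ∀ f : Fin 3 → Set M,
      ((∀ i, IsCurve T (f i)) ∧ (Pairwise fun i j => Disjoint (f i) (f j)) ∧
        (∀ i, IsNonSeparating T (f i)) ∧ (∀ i, BoundsDisc T (spineHandlebody T i) (f i)) ∧
        (∀ i j, i ≠ j → IsConnected (centralSurfaceSet T \ (f i ∪ f j))) ∧
        ¬ IsPreconnected (centralSurfaceSet T \ ⋃ i, f i)) →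
      ¬ IsWeaklyReducible T →
      ∃ (X' : Type) (_ : TopologicalSpace X') (_ : T2Space X') (_ : SecondCountableTopology X')
        (_ : ChartedSpace (EuclideanSpace ℝ (Fin 4)) X') (_ : IsManifold (𝓡 4) ∞ X')
        (g' : ℕ) (k' : Fin 3 → ℕ) (T' : Fin 3 → Set X')
        (ℓ : Metric.sphere (0 : EuclideanSpace ℝ (Fin 2)) 1 → X'),
        g' ≤ 2 ∧ IsGKTrisection X' g' k' T' ∧ IsCircleSurgery (𝓡 4) (𝓡 4) X' M ℓ := by
  intro M _ _ _ _ _ e _T _hT _f _hf _hwr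
  obtain ⟨Φ⟩ := hS M ‹_› ‹_› e
  obtain ⟨X', _, _, _, _, _, g', k', T', ℓ, hg', hT', hs⟩ := hP
  exact ⟨X', ‹_›, ‹_›, ‹_›, ‹_›, ‹_›, g', k', T', ℓ, hg', hT', isCircleSurgery_of_diffeomorph_result hs Φ.symm⟩

end Summit.SmoothPoincare4.SmoothPoincare4.Theorems.DependentTripleGenusThreeStandard.Negative

end
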